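/-
Copyright (c) 2026 the pub-hodgecm-mathlib formalisation cell (harness21).  Prover seat hodgecm-mathlib-LH4-p12 (g4), Track A «(D-RAM) FOUR-FRAME», unit U2H, the census leaf
(ρ2b′-X) `stub_U2H_fixedPointCensus_typeTwo_unit0` — RHO2BX-ORDER v1 (payer LH4-p14 (g3)) organ O-Cone: the CONE INDEX-SET CENSUS at tube coordinate `b ≥ 1`.  2026-09-04.
-/
import Summits.HodgeConjecture.HodgeConjecture.Theorems.F0P3cDyRamConeLevelTransportIn   -- (L→); brings «OUT» (L←), ★ (C)(D1–D4), ★ (A)(B)(C′), ★ (W1)–(W4), ★ DEFS leaf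
import HarnessLib

/-!
# Crux `H413`, line LH4 «(D-RAM) FOUR-FRAME», leaf (ρ2b′-X) — organ O-Cone, the CONE INDEX-SET CENSUS: at tube coordinate `b ≥ 1`,
# `#{B ⊂ E² : B = g𝒪², γ₂B = B, ∃ w₀ (G1) ∧ (B^♯ = B + 𝒪w₀) ∧ |⟨w₀,w₀⟩|·|ϖ|^{2b} = 1 ∧ γ₂w₀ − u•w₀ ∈ B} = Σ_{j ≤ J} [lam ∈ 𝒪_j] · #levelSetDep(j, b; lam − jE u)`

Cell `hodgecm-mathlib` (D-0151), FLOOR 0, crux H413 = `stmt-HodgeConjecture-24833`, unit U2H, leaf (ρ2b′-X) (OPEN-CONFIRMED, T18-55); RHO2BX-ORDER v1 organ **O-Cone** (LH4-p12 (g4)).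
THEOREMS ONLY (no `def`, no instance, no notation, no `sorry`); lane `--supports stmt-HodgeConjecture-24833 --as helper` (count-neutral).  WHY: the integer interface hOrg of the payer's
★ layer 4 (p857277 `latticeCensus_literals_of_signedCensus`) needs `N t = #{M self-dual : tM = M}` as AXIS TERM (★ W4 p857271 `ncard_orderLatt_selfDual_eq_sum` ∘ ★ (C) p857215) PLUS
the CONE TERMS `Σ_{b ≥ 1} Σ_{(B, b)} #fibre^Γ(B, b)` (★ T2a p857187 ∕ ★ T2b p857229 ∕ ★ T2c p857252, fibration LH4-p07 (g6)); THIS FILE counts the INDEX SET of the inner sum — the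
W-parts `B` at tube `b` carrying T2b's binders and the tube criterion — by the line model's depth-refined level sets, which T5a∕b∕c (LH4-p08 ∕ F0P3-p01 ∕ LH4-p06 (g4)) tabulate:
the bijection is ★ (L→) `exists_mem_levelSetDep_map` ∕ ★ (L←) `exists_coneData_of_mem_levelSetDep` with `B ↦ φ(B)` (injective, ★ `map_toAddSubgroup_injective`), and the union over
the conductor exponent `j` is disjoint (★ `eq_of_mem_levelSet_of_mem_levelSet`) and truncates at `J` (`lam ∉ 𝒪_{J+1}`, ★ `not_isOrd_pow_of_lt`).
* §1 `ncard_iUnion_eq_sum_of_disjoint` — counting a disjoint, eventually empty union (the ★ W4 pattern, packaged once).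
* §2 `setOf_coneWPart_image_eq_iUnion` ∕ **`ncard_coneWParts_eq_ncard_iUnion`** — the bijection.
* §3 **`ncard_coneWParts_eq_sum`** — the census.
HONEST LABEL: count-neutral; HC_CM is proved only modulo the 7 printed citations (2 remaining named inputs: hLiu418 = `stmt-HodgeConjecture-24832`, h413 = `stmt-HodgeConjecture-24833`) until
rung 0 closes.

## References
* [Kottwitz1986BaseChangeUnits] R. E. Kottwitz, *Base change for unit elements of Hecke algebras*, Compositio Math. 60 (1986), §1 pp. 240–241.
* [Jacobowitz1962] R. Jacobowitz, *Hermitian forms over local fields*, Amer. J. Math. 84 (1962), §4.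
* [BruhatTits1972] F. Bruhat, J. Tits, *Groupes réductifs sur un corps local I*, Publ. Math. IHÉS 41 (1972), §10.
-/

set_option autoImplicit false

noncomputable section

open scoped Valued WithZero Matrix MatrixGroups
open WithZero
open scoped Classical
open Literature.NumberTheory.Automorphic Literature.NumberTheory.Automorphic.HermitianLattice Literature.NumberTheory.Automorphic.UnitaryLatticeTree
open Literature.NumberTheory.Automorphic.EllipticPlaneAsFieldLine
open Literature.NumberTheory.LocalFields.QuadraticOrder
open Summit.HodgeConjecture.HodgeConjecture.Cruxes.H413.F0P3cDyRamToricCensusDefs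
open Summit.HodgeConjecture.HodgeConjecture.Cruxes.H413.F0P3cDyRamWSideOrderCensus

namespace Summit.HodgeConjecture.HodgeConjecture.Cruxes.H413.F0P3cDyRamConeLevelTransport

variable {E M : Type*} [Field E] [Valued E ℤᵐ⁰] [Field M] [Valued M ℤᵐ⁰] {ρ Θ : M →+* M} {α : M}

/-! ## §1 Counting a disjoint, eventually empty union -/

/-- A disjoint family of finite sets, empty beyond `J`, has `#⋃ = Σ_{j ≤ J} #`. [cite: Kottwitz1986BaseChangeUnits, §1 pp. 240–241] -/
theorem ncard_iUnion_eq_sum_of_disjoint {X : Type*} (S : ℕ → Set X) (hfin : ∀ j, (S j).Finite) (hdisj : ∀ i j, i ≠ j → Disjoint (S i) (S j))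
    {J : ℕ} (hempty : ∀ j, J < j → S j = ∅) : (⋃ j, S j).ncard = ∑ j ∈ Finset.range (J + 1), (S j).ncard := by
  classical
  have hUnion : (⋃ j : ℕ, S j) = ⋃ j ∈ Finset.range (J + 1), S j := by
    ext x
    simp only [Set.mem_iUnion, Finset.mem_range, exists_prop]
    constructor
    · rintro ⟨j, hj⟩
      refine ⟨j, ?_, hj⟩
      by_contra hJj
      have : S j = ∅ := hempty j (by omega)
      rw [this] at hj; exact hj
    · rintro ⟨j, -, hj⟩; exact ⟨j, hj⟩
  rw [hUnion]
  have hgen : ∀ n : ℕ, (⋃ j ∈ Finset.range n, S j).ncard = ∑ j ∈ Finset.range n, (S j).ncard := by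
    intro n
    induction n with
    | zero => simp
    | succ n ih =>
      rw [Finset.range_add_one, Finset.sum_insert Finset.notMem_range_self, Finset.set_biUnion_insert]
      have hd : Disjoint (S n) (⋃ x ∈ Finset.range n, S x) := by
        rw [Set.disjoint_left]
        intro x hn hU
        simp only [Set.mem_iUnion, Finset.mem_range, exists_prop] at hU
        obtain ⟨j, hj, hxj⟩ := hU
        exact (Set.disjoint_left.1 (hdisj n j (by omega))) hn hxj
      rw [Set.ncard_union_eq hd (hfin n) ?_, ih]
      exact (Finset.range n).finite_toSet.biUnion fun j _ => hfin j
  exact hgen (J + 1)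

/-! ## §2 The bijection `B ↦ φ(B)` between cone W-parts at tube `b` and depth-refined level-`b` members -/

/-- **THE IMAGE of the cone W-parts at tube `b` under `B ↦ φ(B)` is `⋃_j (levelSetDep(j, b; lam − jE u) ∩ {lam ∈ 𝒪_j})`** (★ (L→) ⊆, ★ (L←) ⊇).
[cite: Jacobowitz1962, §4] [cite: Kottwitz1986BaseChangeUnits, §1 pp. 240–241] -/
theorem setOf_coneWPart_image_eq_iUnion (σ : E →+* E) {ϖ : E} (hϖ0 : ϖ ≠ 0) (hϖ1 : Valued.v ϖ < 1) (H₂ : Matrix (Fin 2) (Fin 2) E) (jE : E →+* M)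
    (hρρ : ∀ x, ρ (ρ x) = x) (hvρ : ∀ x, Valued.v (ρ x) = Valued.v x) (hα : ρ α ≠ α) (hα1 : Valued.v α ≤ 1)
    (hint : ∀ z : M, Valued.v z ≤ 1 → Valued.v ((z - ρ z) / (α - ρ α)) ≤ 1)
    (hΘΘ : ∀ x, Θ (Θ x) = x) (hΘρ : ∀ x, Θ (ρ x) = ρ (Θ x)) (hvΘ : ∀ x, Valued.v (Θ x) = Valued.v x)
    (hjv : ∀ c, Valued.v (jE c) ≤ 1 ↔ Valued.v c ≤ 1) (hjfix : ∀ z, ρ z = z ↔ ∃ c, jE c = z)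
    (hjpow : ∀ (t : E) (n : ℤ), Valued.v (jE t) = Valued.v (jE ϖ) ^ n ↔ Valued.v t = Valued.v ϖ ^ n)
    (hEval : ∀ c : M, ρ c = c → c ≠ 0 → Valued.v c ≤ 1 → ∃ n : ℕ, Valued.v c = Valued.v (jE ϖ) ^ n)
    (hϖmax : ∀ t : M, ρ t = t → Valued.v t < 1 → Valued.v t ≤ Valued.v (jE ϖ))
    (φ : (Fin 2 → E) →+ M) (hφs : ∀ (c : E) (x : Fin 2 → E), φ (c • x) = jE c * φ x) (hφi : Function.Injective φ) (hφo : Function.Surjective φ)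
    {γ₂ : GL (Fin 2) E} {lam h : M} (hφγ : ∀ x, φ ((γ₂ : Matrix (Fin 2) (Fin 2) E).mulVec x) = lam * φ x) (hlam : Valued.v lam = 1)
    (hΘh : Θ h = h) (hh : h ≠ 0) (hform : ∀ x y, jE (pairing σ H₂ x y) = h * Θ (φ x) * φ y + ρ (h * Θ (φ x) * φ y))
    {u : E} (hu : Valued.v u ≤ 1) {b : ℕ} (hb : 1 ≤ b) :
    (fun B : Submodule 𝒪[E] (Fin 2 → E) => B.toAddSubgroup.map φ) ''
        {B : Submodule 𝒪[E] (Fin 2 → E) | (∃ g : GL (Fin 2) E, B = latt (g : Matrix (Fin 2) (Fin 2) E)) ∧ mapGL γ₂ B = B ∧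
          ∃ w₀ : Fin 2 → E, (∀ w, w ∈ B ↔ (w ∈ dualLatt σ H₂ B ∧ Valued.v (pairing σ H₂ w₀ w) ≤ 1)) ∧
            (∀ w ∈ dualLatt σ H₂ B, ∃ (t : E) (a : Fin 2 → E), Valued.v t ≤ 1 ∧ a ∈ B ∧ w = t • w₀ + a) ∧
            Valued.v (pairing σ H₂ w₀ w₀) * Valued.v ϖ ^ (2 * b) = 1 ∧ (γ₂ : Matrix (Fin 2) (Fin 2) E).mulVec w₀ - u • w₀ ∈ B} =
      ⋃ j : ℕ, {Λ : AddSubgroup M | Λ ∈ levelSetDep ρ Θ α (jE ϖ) h j b (lam - jE u) ∧ IsOrd ρ α (jE ϖ ^ j) lam} := by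
  ext Λ
  simp only [Set.mem_image, Set.mem_setOf_eq, Set.mem_iUnion]
  constructor
  · rintro ⟨B, ⟨hBg, hfix, w₀, hG1, hgen, hw₀, hdep⟩, rfl⟩
    exact exists_mem_levelSetDep_map σ hϖ0 hϖ1 H₂ jE hρρ hvρ hα hα1 hint hΘΘ hΘρ hvΘ hjv hjfix hjpow hEval hϖmax φ hφs hφi hφo hφγ hlam hΘh hh hform
      hu hb hBg hfix hG1 hgen hw₀ hdep
  · rintro ⟨j, hΛ, hlamj⟩
    obtain ⟨B, hBΛ, hBg, hfix, w₀, hG1, hgen, hw₀, hdep⟩ := exists_coneData_of_mem_levelSetDep σ hϖ0 hϖ1 H₂ jE hρρ hvρ hα hα1 hint hΘΘ hΘρ hvΘ hjv hjfix hjpow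
      hϖmax φ hφs hφi hφo hφγ hlam hΘh hh hform u hb hΛ hlamj
    exact ⟨B, ⟨hBg, hfix, w₀, hG1, hgen, hw₀, hdep⟩, hBΛ⟩

/-- **`#(cone W-parts at tube b) = #⋃_j (levelSetDep(j, b; lam − jE u) ∩ {lam ∈ 𝒪_j})`** (`B ↦ φ(B)` is injective, ★ `map_toAddSubgroup_injective`).
[cite: Jacobowitz1962, §4] [cite: Kottwitz1986BaseChangeUnits, §1 pp. 240–241] -/
theorem ncard_coneWParts_eq_ncard_iUnion (σ : E →+* E) {ϖ : E} (hϖ0 : ϖ ≠ 0) (hϖ1 : Valued.v ϖ < 1) (H₂ : Matrix (Fin 2) (Fin 2) E) (jE : E →+* M)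
    (hρρ : ∀ x, ρ (ρ x) = x) (hvρ : ∀ x, Valued.v (ρ x) = Valued.v x) (hα : ρ α ≠ α) (hα1 : Valued.v α ≤ 1)
    (hint : ∀ z : M, Valued.v z ≤ 1 → Valued.v ((z - ρ z) / (α - ρ α)) ≤ 1)
    (hΘΘ : ∀ x, Θ (Θ x) = x) (hΘρ : ∀ x, Θ (ρ x) = ρ (Θ x)) (hvΘ : ∀ x, Valued.v (Θ x) = Valued.v x)
    (hjv : ∀ c, Valued.v (jE c) ≤ 1 ↔ Valued.v c ≤ 1) (hjfix : ∀ z, ρ z = z ↔ ∃ c, jE c = z)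
    (hjpow : ∀ (t : E) (n : ℤ), Valued.v (jE t) = Valued.v (jE ϖ) ^ n ↔ Valued.v t = Valued.v ϖ ^ n)
    (hEval : ∀ c : M, ρ c = c → c ≠ 0 → Valued.v c ≤ 1 → ∃ n : ℕ, Valued.v c = Valued.v (jE ϖ) ^ n)
    (hϖmax : ∀ t : M, ρ t = t → Valued.v t < 1 → Valued.v t ≤ Valued.v (jE ϖ))
    (φ : (Fin 2 → E) →+ M) (hφs : ∀ (c : E) (x : Fin 2 → E), φ (c • x) = jE c * φ x) (hφi : Function.Injective φ) (hφo : Function.Surjective φ)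
    {γ₂ : GL (Fin 2) E} {lam h : M} (hφγ : ∀ x, φ ((γ₂ : Matrix (Fin 2) (Fin 2) E).mulVec x) = lam * φ x) (hlam : Valued.v lam = 1)
    (hΘh : Θ h = h) (hh : h ≠ 0) (hform : ∀ x y, jE (pairing σ H₂ x y) = h * Θ (φ x) * φ y + ρ (h * Θ (φ x) * φ y))
    {u : E} (hu : Valued.v u ≤ 1) {b : ℕ} (hb : 1 ≤ b) :
    {B : Submodule 𝒪[E] (Fin 2 → E) | (∃ g : GL (Fin 2) E, B = latt (g : Matrix (Fin 2) (Fin 2) E)) ∧ mapGL γ₂ B = B ∧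
        ∃ w₀ : Fin 2 → E, (∀ w, w ∈ B ↔ (w ∈ dualLatt σ H₂ B ∧ Valued.v (pairing σ H₂ w₀ w) ≤ 1)) ∧
          (∀ w ∈ dualLatt σ H₂ B, ∃ (t : E) (a : Fin 2 → E), Valued.v t ≤ 1 ∧ a ∈ B ∧ w = t • w₀ + a) ∧
          Valued.v (pairing σ H₂ w₀ w₀) * Valued.v ϖ ^ (2 * b) = 1 ∧ (γ₂ : Matrix (Fin 2) (Fin 2) E).mulVec w₀ - u • w₀ ∈ B}.ncard =
      (⋃ j : ℕ, {Λ : AddSubgroup M | Λ ∈ levelSetDep ρ Θ α (jE ϖ) h j b (lam - jE u) ∧ IsOrd ρ α (jE ϖ ^ j) lam}).ncard := by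
  rw [← setOf_coneWPart_image_eq_iUnion σ hϖ0 hϖ1 H₂ jE hρρ hvρ hα hα1 hint hΘΘ hΘρ hvΘ hjv hjfix hjpow hEval hϖmax φ hφs hφi hφo hφγ hlam hΘh hh hform hu hb,
    Set.ncard_image_of_injective _ fun B B' hBB' => map_toAddSubgroup_injective φ hφi hBB']

/-! ## §3 The census -/

/-- **THE CONE INDEX-SET CENSUS at tube `b ≥ 1`: `#(cone W-parts at tube b) = Σ_{j ≤ J} [lam ∈ 𝒪_j] · #levelSetDep(j, b; lam − jE u)`** (`lam ∉ 𝒪_{J+1}`; the level sets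
`levelSet(j, b)`, `j ≤ J`, finite). [cite: Jacobowitz1962, §4] [cite: Kottwitz1986BaseChangeUnits, §1 pp. 240–241] [cite: BruhatTits1972, §10] -/
theorem ncard_coneWParts_eq_sum (σ : E →+* E) {ϖ : E} (hϖ0 : ϖ ≠ 0) (hϖ1 : Valued.v ϖ < 1) (H₂ : Matrix (Fin 2) (Fin 2) E) (jE : E →+* M)
    (hρρ : ∀ x, ρ (ρ x) = x) (hvρ : ∀ x, Valued.v (ρ x) = Valued.v x) (hα : ρ α ≠ α) (hα1 : Valued.v α ≤ 1)
    (hint : ∀ z : M, Valued.v z ≤ 1 → Valued.v ((z - ρ z) / (α - ρ α)) ≤ 1)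
    (hΘΘ : ∀ x, Θ (Θ x) = x) (hΘρ : ∀ x, Θ (ρ x) = ρ (Θ x)) (hvΘ : ∀ x, Valued.v (Θ x) = Valued.v x)
    (hjv : ∀ c, Valued.v (jE c) ≤ 1 ↔ Valued.v c ≤ 1) (hjfix : ∀ z, ρ z = z ↔ ∃ c, jE c = z)
    (hjpow : ∀ (t : E) (n : ℤ), Valued.v (jE t) = Valued.v (jE ϖ) ^ n ↔ Valued.v t = Valued.v ϖ ^ n)
    (hEval : ∀ c : M, ρ c = c → c ≠ 0 → Valued.v c ≤ 1 → ∃ n : ℕ, Valued.v c = Valued.v (jE ϖ) ^ n)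
    (hϖmax : ∀ t : M, ρ t = t → Valued.v t < 1 → Valued.v t ≤ Valued.v (jE ϖ))
    (φ : (Fin 2 → E) →+ M) (hφs : ∀ (c : E) (x : Fin 2 → E), φ (c • x) = jE c * φ x) (hφi : Function.Injective φ) (hφo : Function.Surjective φ)
    {γ₂ : GL (Fin 2) E} {lam h : M} (hφγ : ∀ x, φ ((γ₂ : Matrix (Fin 2) (Fin 2) E).mulVec x) = lam * φ x) (hlam : Valued.v lam = 1)
    (hΘh : Θ h = h) (hh : h ≠ 0) (hform : ∀ x y, jE (pairing σ H₂ x y) = h * Θ (φ x) * φ y + ρ (h * Θ (φ x) * φ y))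
    {u : E} (hu : Valued.v u ≤ 1) {b : ℕ} (hb : 1 ≤ b) {J : ℕ} (hJ : ¬ IsOrd ρ α (jE ϖ ^ (J + 1)) lam)
    (hfin : ∀ j, j ≤ J → (levelSet ρ Θ α (jE ϖ) h j b).Finite) :
    {B : Submodule 𝒪[E] (Fin 2 → E) | (∃ g : GL (Fin 2) E, B = latt (g : Matrix (Fin 2) (Fin 2) E)) ∧ mapGL γ₂ B = B ∧
        ∃ w₀ : Fin 2 → E, (∀ w, w ∈ B ↔ (w ∈ dualLatt σ H₂ B ∧ Valued.v (pairing σ H₂ w₀ w) ≤ 1)) ∧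
          (∀ w ∈ dualLatt σ H₂ B, ∃ (t : E) (a : Fin 2 → E), Valued.v t ≤ 1 ∧ a ∈ B ∧ w = t • w₀ + a) ∧
          Valued.v (pairing σ H₂ w₀ w₀) * Valued.v ϖ ^ (2 * b) = 1 ∧ (γ₂ : Matrix (Fin 2) (Fin 2) E).mulVec w₀ - u • w₀ ∈ B}.ncard =
      ∑ j ∈ Finset.range (J + 1), (if IsOrd ρ α (jE ϖ ^ j) lam then (levelSetDep ρ Θ α (jE ϖ) h j b (lam - jE u)).ncard else 0) := by
  classical
  rw [ncard_coneWParts_eq_ncard_iUnion σ hϖ0 hϖ1 H₂ jE hρρ hvρ hα hα1 hint hΘΘ hΘρ hvΘ hjv hjfix hjpow hEval hϖmax φ hφs hφi hφo hφγ hlam hΘh hh hform hu hb]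
  have hρϖ : ρ (jE ϖ) = jE ϖ := (hjfix _).2 ⟨ϖ, rfl⟩
  have hϖE0 : jE ϖ ≠ 0 := (map_ne_zero jE).2 hϖ0
  have hϖE1 : Valued.v (jE ϖ) < 1 := by
    refine lt_of_le_of_ne ((hjv ϖ).2 hϖ1.le) fun hle => ?_
    have := (hjpow ϖ 0).1 (by rw [zpow_zero]; exact hle)
    rw [zpow_zero] at this
    exact hϖ1.ne this
  set S : ℕ → Set (AddSubgroup M) := fun j => {Λ | Λ ∈ levelSetDep ρ Θ α (jE ϖ) h j b (lam - jE u) ∧ IsOrd ρ α (jE ϖ ^ j) lam} with hS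
  have hSempty' : ∀ j, ¬ IsOrd ρ α (jE ϖ ^ j) lam → S j = ∅ := by
    intro j hj
    ext Λ
    simp only [hS, Set.mem_setOf_eq, Set.mem_empty_iff_false, iff_false, not_and]
    exact fun _ => hj
  have hSempty : ∀ j, J < j → S j = ∅ := fun j hj => hSempty' j (not_isOrd_pow_of_lt hϖE1.le hJ hj)
  have hSfin : ∀ j, (S j).Finite := by
    intro j
    by_cases hj : j ≤ J
    · exact (hfin j hj).subset fun Λ hΛ => levelSetDep_subset ρ Θ α (jE ϖ) h j b (lam - jE u) hΛ.1
    · rw [hSempty j (by omega)]; exact Set.finite_empty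
  have hSdisj : ∀ i j, i ≠ j → Disjoint (S i) (S j) := by
    intro i j hij
    rw [Set.disjoint_left]
    intro Λ hi hj
    exact hij (eq_of_mem_levelSet_of_mem_levelSet hvρ hα hα1 hint hρϖ hϖE0 hϖE1 h
      (levelSetDep_subset ρ Θ α (jE ϖ) h i b (lam - jE u) hi.1) (levelSetDep_subset ρ Θ α (jE ϖ) h j b (lam - jE u) hj.1))
  have hScard : ∀ j, (S j).ncard = if IsOrd ρ α (jE ϖ ^ j) lam then (levelSetDep ρ Θ α (jE ϖ) h j b (lam - jE u)).ncard else 0 := by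
    intro j
    split_ifs with hlamj
    · congr 1; ext Λ; simp only [hS, Set.mem_setOf_eq, and_iff_left_iff_imp]; exact fun _ => hlamj
    · rw [hSempty' j hlamj, Set.ncard_empty]
  rw [show (⋃ j : ℕ, {Λ : AddSubgroup M | Λ ∈ levelSetDep ρ Θ α (jE ϖ) h j b (lam - jE u) ∧ IsOrd ρ α (jE ϖ ^ j) lam}) = ⋃ j : ℕ, S j from rfl,
    ncard_iUnion_eq_sum_of_disjoint S hSfin hSdisj hSempty]
  exact Finset.sum_congr rfl fun j _ => hScard j

end Summit.HodgeConjecture.HodgeConjecture.Cruxes.H413.F0P3cDyRamConeLevelTransport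

end
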